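import Mathlib
import Summits.HodgeConjecture.FermatCycles.HodgeFermatThmFstarStatement

/-!
# LEMMA N with (N-λ) and the fibre identities (E) — part 1: the model, residue sums, the `p` lifts (`HodgeFermat/LemmaN.lean`)

Tree copy (part 1 of 2) of the module `HodgeFermat/LemmaN.lean` of the sibling cell's standalone package
`run/shared/lean/pub/pub-hodgefermat/lean/HodgeFermat/` (503 lines, sha256 `b5c1c16bd86d874d…`), source lines 52–59 and 70–242 (the model `rsum`/`fibreCount`, residue sums and carries, the `p` lifts).
Filed by cell `pub-hfermat`, seat prover-1 gen-0, on the COORDINATOR KEEPER RULING of 2026-08-25 (gem sweep H1: take the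
off-gate kernel theorem `thmFstar` — `HodgeFermat/DecodingFinal.lean:29` — through the gate); this file is one link of the
minimal import closure of `thmFstar`.  The source module's declarations are VERBATIM those of the cell record
`check/DecodingFinal_standalone.lean` (27 bodies, 454 223 B, sha256 dca6f17de93119a6…, hub `lean check` rc 0, 130.1 s; pub-hodgefermat `CERT.md` l.978, GATE HF-G32).
Deviations from the source module, exhaustively: the `import` lines (tree modules `Summits.HodgeConjecture.FermatCycles.
HodgeFermat*` instead of `HodgeFermat.*`); this module docstring; the three model declarations `InH`, `instDecidableInH`, `SameType` (source l.60–69) are NOT repeated here — they are declared, verbatim, in `HodgeFermatThmFstarStatement.lean` (imported); one-line docstrings added (gate lint) to `liftB_spec`, `liftB_injOn`, `liftB_image`; the file ends at source l.242 with an `end` line (part 2 = `HodgeFermatLemmaNB.lean`).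
Every other line — in particular every declaration's statement and proof — is byte-identical to the source.
HONEST FRAMING: explicit algebraic cycles for specific Hodge classes on Fermat/Delsarte varieties; residual open instances
listed; no claim on general Hodge.  (This file is arithmetic of CM types; it claims nothing about cycles.)

The source module's docstring (LemmaN.lean l.3–50), verbatim:

## LEMMA N with (N-λ) and the fibre identities (E) — for EVERY prime `p` and EVERY level `n`
## (`tables/KR-FREE.md` §1, `tables/DPRIME-THEOREM.md` §1; build hodge-fermat, generation 21, addendum)

Setting (KR-FREE §0–§1).  `N = pn` with `p` prime, `p ∤ n` (no other hypothesis on `n ≥ 1`: squarefreeness of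
`n` is not needed for LEMMA N).  A triple `T = (a, b, c)` of level `N` (`N ∣ a + b + c`); `H_T = {t : ⟨ta⟩_N +
⟨tb⟩_N < N}`; the CM type of `T` is `H_T ∩ (ℤ/N)ˣ` (`SameType`).  For a unit `t̄₀ ∈ (ℤ/n)ˣ` the FIBRE COUNT
`N_T(t̄₀) = #{t ∈ (ℤ/N)ˣ ∩ H_T : t ≡ t₀ mod n}` (`fibreCount p n T t₀`: the unit lifts are `t₀ + jn`, `j < p`,
minus the unique one divisible by `p`), the carry `c_T̄(t̄) ∈ {1, 2}` of the reduced triple (`n · c_T̄(t̄) =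
rsum n T t = ⟨ta⟩_n + ⟨tb⟩_n + ⟨tc⟩_n`), `t̄₁ = p̄⁻¹ t̄₀` (`p t₁ ≡ t₀ mod n`), and for a triple of type Z1 at `p`,
`T = (py, x₂, x₃)` with `p ∤ x₂x₃`, the digit `k₁ = ⌊p⟨t₀y⟩_n / n⌋` (for `y = n/p`-normalised triples this is
K-R's `λ`; (N-λ): `#{units among the lifts with B-value < p − k₁…}` is absorbed in the closed form below).

What this file proves, for ALL `p, n, T, t₀` as above (theorem names in brackets):
* LEMMA N (U)  [`lemmaN_U`]:  if `p ∤ abc` then  `N_T(t̄₀) = (p − 1)/2 + c_T̄(t̄₁) − c_T̄(t̄₀)`,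
  stated over ℕ as `2n·N_T(t̄₀) + 2·rsum_n(t₀) + n = pn + 2·rsum_n(t₁)`.
* LEMMA N (Z1) with (N-λ)  [`lemmaN_Z1`]:  if `T = (py, x₂, x₃)`, `p ∤ x₂x₃`, then
  `N_T(t̄₀) = p − 1 − k₁ + c_T̄(t̄₁) − c_T̄(t̄₀)`, stated as `n·N_T(t̄₀) + n·k₁ + rsum_n(t₀) + n = pn + rsum_n(t₁)`.
* the FIBRE IDENTITIES (E)  [`fibre_identity_Z1Z1`, `fibre_identity_Z1U`, `fibre_identity_UU`]: two triples of
  the same CM type have equal fibre counts (`fibreCount_congr`), whence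
  Z1–Z1: `k₁ + c(t̄₀) + c'(t̄₁) = k₁' + c'(t̄₀) + c(t̄₁)`;  Z1–U: `2k₁ + 2c(t̄₀) + 2c'(t̄₁) + 1 = p + 2c(t̄₁) + 2c'(t̄₀)`;
  U–U: `c(t̄₀) + c'(t̄₁) = c'(t̄₀) + c(t̄₁)`.
These are the two counting lemmas on which PROPOSITIONS L5, Z5 (p = 5; `PropL5.lean`, `PropZ5.lean` prove the
p = 5 instances they need inline) and LEMMA O / PROPOSITION Z7 / THEOREM D′ (p ≥ 7, `tables/DPRIME-THEOREM.md`)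
rest; with this file the p ≥ 7 slices can import the closed forms instead of re-deriving them.

Proof (elementary, self-contained; K-R 1978 is not used).  Write the `p` lifts of `t̄₀` as `t₀ + jn`, `j < p`.
(i) [`liftB_spec`, `lift_ne`, `liftB_image`, `lift_sum`]  For an entry `x` with `p ∤ x` the residues
`⟨(t₀ + jn)x⟩_N = n·B_j + ⟨t₀x⟩_n` have pairwise distinct `B_j < p`, so `{B_j} = {0, …, p − 1}` and
`Σ_j ⟨(t₀ + jn)x⟩_N = p⟨t₀x⟩_n + n·p(p−1)/2`;  for the entry `py` of a Z1 triple the residue is the constant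
`p⟨t₀y⟩_n = n·k₁ + ⟨t₀·py⟩_n` [`first_mod`].
(ii) [`nonunit_exists`, `nonunit_unique`, `lift_coprime`]  Exactly one lift `t₀ + j₀n = p t'` is divisible by
`p`, and `t' ≡ t₁ mod n`; the other `p − 1` lifts are units of `ℤ/N`.
(iii) [`rsum_cases`, `lifts_total`]  A unit lift has residue sum `N` or `2N`, and lies in `H_T` iff the sum is
`N` (this needs only `p ∤` the THIRD entry); the non-unit lift has residue sum `p · rsum_n(t') = p·n·c_T̄(t̄₁)`
[`rsum_p_mul`, `rsum_congr`].  Hence `Σ_j rsum_N(t₀ + jn) + N · N_T(t̄₀) = (p − 1)·2N + p·n·c_T̄(t̄₁)`.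
(iv) Comparing (iii) with the entrywise sums (i) gives the two closed forms by linear arithmetic
(`zify` + `linear_combination`, after `p = m + 1`).

Kernel instances (`decide`) at `p = 7`, `n = 11`: `N_T(3̄) = 1` for `T = (21, 10, 46)` with `k₁ = 5`, `c = c_* = 2`
(`1 = 6 − 5 + 2 − 2`), and `N_{T'}(3̄) = 3` for `T' = (1, 2, 74)` (`3 = 3 + 1 − 1`); both theorems are instantiated
on these data, so their hypotheses are satisfiable and the two ℕ-identities are non-vacuous.

`import Mathlib` only (self-contained; the definitions `InH`, `SameType`, `rsum` are verbatim those of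
`PropL5.lean`, in the namespace `HodgeFermat.KRFree.LemmaN`); `set_option autoImplicit false`; no `sorry`, no
`native_decide`; axioms of every theorem = [propext, Classical.choice, Quot.sound]; hub `lean check` rc 0,
0 errors, 0 warnings.
-/

set_option autoImplicit false

namespace HodgeFermat.KRFree.LemmaN

open Finset

/-! ## The model (same definitions as `PropL5.lean`) -/

-- `InH`, `instDecidableInH`, `SameType` (source l.60–69): declared verbatim in `HodgeFermatThmFstarStatement.lean`.

/-- the residue sum `⟨ta⟩_N + ⟨tb⟩_N + ⟨tc⟩_N` (`= N · carry`; at level `n = N/p` it is `n · c_T̄(t̄)`) -/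
def rsum (N : ℕ) (T : ℕ × ℕ × ℕ) (t : ℕ) : ℕ :=
  (t * T.1) % N + (t * T.2.1) % N + (t * T.2.2) % N

/-- the fibre count `N_T(t̄₀)` at the prime `p` (`N = pn`): the number of UNIT lifts `t₀ + jn`, `j < p`,
of `t̄₀ ∈ ℤ/n` that lie in `H_T` -/
def fibreCount (p n : ℕ) (T : ℕ × ℕ × ℕ) (t₀ : ℕ) : ℕ :=
  ((range p).filter (fun j => Nat.Coprime (t₀ + j * n) (p * n) ∧ InH (p * n) T (t₀ + j * n))).card

/-! ## Residue sums and carries -/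

/-- three residues `< N`, the last one positive, with sum divisible by `N`, sum to `N` or `2N` -/
lemma carry_cases {N r₁ r₂ r₃ : ℕ} (h₁ : r₁ < N) (h₂ : r₂ < N) (h₃ : 0 < r₃) (h₃' : r₃ < N)
    (hd : N ∣ r₁ + r₂ + r₃) : r₁ + r₂ + r₃ = N ∨ r₁ + r₂ + r₃ = 2 * N := by
  obtain ⟨k, hk⟩ := hd
  have hk1 : 1 ≤ k := by
    by_contra h0
    have : k = 0 := by omega
    subst this; omega
  have hk2 : k ≤ 2 := by
    by_contra h3
    have : N * 3 ≤ N * k := Nat.mul_le_mul_left N (by omega)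
    omega
  interval_cases k <;> omega

/-- the residue sum of `T = (x, y, z)` at `t` is divisible by `N` when `N ∣ x + y + z` -/
lemma rsum_dvd {N x y z : ℕ} (t : ℕ) (hs : N ∣ x + y + z) : N ∣ rsum N (x, y, z) t := by
  unfold rsum
  simp only
  have h : N ∣ t * x + t * y + t * z := by
    rw [← Nat.mul_add, ← Nat.mul_add]; exact Dvd.dvd.mul_left hs t
  have h1 : t * x % N ≡ t * x [MOD N] := Nat.mod_modEq _ _
  have h2 : t * y % N ≡ t * y [MOD N] := Nat.mod_modEq _ _
  have h3 : t * z % N ≡ t * z [MOD N] := Nat.mod_modEq _ _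
  exact (Nat.modEq_zero_iff_dvd.mp (((h1.add h2).add h3).trans (Nat.modEq_zero_iff_dvd.mpr h)))

/-- for `N ∣ x + y + z` and `N ∤ tz`: the residue sum at `t` is `N` or `2N`, and `t ∈ H_T ↔` it is `N` -/
lemma rsum_cases {N x y z t : ℕ} (hN : 0 < N) (hs : N ∣ x + y + z) (hz : ¬ N ∣ t * z) :
    (rsum N (x, y, z) t = N ∨ rsum N (x, y, z) t = 2 * N)
      ∧ (InH N (x, y, z) t ↔ rsum N (x, y, z) t = N) := by
  have hd := rsum_dvd t hs
  have h1 : t * x % N < N := Nat.mod_lt _ hN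
  have h2 : t * y % N < N := Nat.mod_lt _ hN
  have h3 : t * z % N < N := Nat.mod_lt _ hN
  have h3' : 0 < t * z % N := Nat.pos_of_ne_zero (fun h => hz (Nat.dvd_of_mod_eq_zero h))
  unfold rsum at hd ⊢
  simp only at hd ⊢
  have hc := carry_cases h1 h2 h3' h3 hd
  unfold InH
  simp only
  omega

/-- `⟨(pt)x⟩_{pn} = p⟨tx⟩_n`: the residue sum of the lift divisible by `p` -/
lemma rsum_p_mul (p n t x y z : ℕ) :
    rsum (p * n) (x, y, z) (p * t) = p * rsum n (x, y, z) t := by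
  unfold rsum
  simp only [mul_assoc, Nat.mul_mod_mul_left]
  ring

/-- the residue sum at level `n` depends only on `t mod n` -/
lemma rsum_congr {n t t' : ℕ} (T : ℕ × ℕ × ℕ) (h : t ≡ t' [MOD n]) : rsum n T t = rsum n T t' := by
  have h1 : t * T.1 ≡ t' * T.1 [MOD n] := h.mul_right _
  have h2 : t * T.2.1 ≡ t' * T.2.1 [MOD n] := h.mul_right _
  have h3 : t * T.2.2 ≡ t' * T.2.2 [MOD n] := h.mul_right _
  unfold Nat.ModEq at h1 h2 h3
  unfold rsum
  rw [h1, h2, h3]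

/-- `N_T(t̄₀)` depends only on the CM type -/
lemma fibreCount_congr {p n t₀ : ℕ} {T T' : ℕ × ℕ × ℕ} (h : SameType (p * n) T T') :
    fibreCount p n T t₀ = fibreCount p n T' t₀ := by
  unfold fibreCount
  apply congrArg Finset.card
  apply Finset.filter_congr
  intro j _
  constructor
  · rintro ⟨hu, hi⟩; exact ⟨hu, (h _ hu).mp hi⟩
  · rintro ⟨hu, hi⟩; exact ⟨hu, (h _ hu).mpr hi⟩

/-! ## The p lifts of `t̄₀`: residues `n·B_j + ⟨t₀x⟩_n` with `{B_j} = {0, …, p−1}` -/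

/-- `B_j := ⌊⟨(t₀ + jn)x⟩_{pn} / n⌋` -/
def liftB (p n t₀ x j : ℕ) : ℕ := (t₀ + j * n) * x % (p * n) / n

/-- `B_j < p` and `⟨(t₀ + jn)x⟩_{pn} = n·B_j + ⟨t₀x⟩_n` -/
lemma liftB_spec (p n t₀ x j : ℕ) (hn : 0 < n) (hp : 0 < p) :
    liftB p n t₀ x j < p ∧ (t₀ + j * n) * x % (p * n) = n * liftB p n t₀ x j + t₀ * x % n := by
  unfold liftB
  constructor
  · exact (Nat.div_lt_iff_lt_mul hn).mpr (Nat.mod_lt _ (Nat.mul_pos hp hn))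
  · have hmod : (t₀ + j * n) * x % (p * n) % n = t₀ * x % n := by
      rw [Nat.mod_mul_left_mod]
      have e : (t₀ + j * n) * x = t₀ * x + (j * x) * n := by ring
      rw [e, Nat.add_mul_mod_self_right]
    have := Nat.div_add_mod ((t₀ + j * n) * x % (p * n)) n
    rw [hmod] at this
    exact this.symm

/-- the residues of the `p` lifts at an entry prime to `p` are pairwise distinct -/
lemma lift_ne {p n t₀ x j j' : ℕ} (hp : p.Prime) (hn : 0 < n) (hx : ¬ p ∣ x) (hjj' : j < j')
    (hj' : j' < p) : (t₀ + j * n) * x % (p * n) ≠ (t₀ + j' * n) * x % (p * n) := by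
  intro h
  obtain ⟨d, rfl⟩ := Nat.exists_eq_add_of_le hjj'.le
  have e : (t₀ + (j + d) * n) * x = (t₀ + j * n) * x + (d * x) * n := by ring
  rw [e] at h
  have h0 : (t₀ + j * n) * x + 0 ≡ (t₀ + j * n) * x + (d * x) * n [MOD p * n] := by
    rw [Nat.add_zero]; exact h
  have h1 : 0 ≡ (d * x) * n [MOD p * n] := Nat.ModEq.add_left_cancel' _ h0
  have h2 : p * n ∣ (d * x) * n := Nat.modEq_zero_iff_dvd.mp h1.symm
  have h3 : p ∣ d * x := Nat.dvd_of_mul_dvd_mul_right hn h2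
  rcases (Nat.Prime.dvd_mul hp).mp h3 with h4 | h4
  · have hd : 0 < d := by omega
    have := Nat.le_of_dvd hd h4
    omega
  · exact hx h4

/-- for `p ∤ x` the map `j ↦ B_j` is injective on `j < p` -/
lemma liftB_injOn {p n t₀ x : ℕ} (hp : p.Prime) (hn : 0 < n) (hx : ¬ p ∣ x) :
    Set.InjOn (liftB p n t₀ x) (↑(range p) : Set ℕ) := by
  intro j hj j' hj' hB
  have hjp : j < p := Finset.mem_range.mp (Finset.mem_coe.mp hj)
  have hjp' : j' < p := Finset.mem_range.mp (Finset.mem_coe.mp hj')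
  have hR : (t₀ + j * n) * x % (p * n) = (t₀ + j' * n) * x % (p * n) := by
    rw [(liftB_spec p n t₀ x j hn hp.pos).2, (liftB_spec p n t₀ x j' hn hp.pos).2, hB]
  by_contra hne
  rcases Nat.lt_or_gt_of_ne hne with hlt | hlt
  · exact lift_ne hp hn hx hlt hjp' hR
  · exact lift_ne hp hn hx hlt hjp hR.symm

/-- for `p ∤ x`: `{B_j : j < p} = {0, …, p − 1}` -/
lemma liftB_image {p n t₀ x : ℕ} (hp : p.Prime) (hn : 0 < n) (hx : ¬ p ∣ x) :
    (range p).image (liftB p n t₀ x) = range p := by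
  apply Finset.eq_of_subset_of_card_le
  · intro i hi
    rw [Finset.mem_image] at hi
    obtain ⟨j, _, rfl⟩ := hi
    exact Finset.mem_range.mpr (liftB_spec p n t₀ x j hn hp.pos).1
  · exact (Finset.card_image_of_injOn (liftB_injOn hp hn hx)).ge

/-- `Σ_{i<p} i`, in the form `2Σ + p = p²` -/
lemma gauss (p : ℕ) : 2 * (∑ i ∈ range p, i) + p = p * p := by
  induction p with
  | zero => simp
  | succ q ih =>
    rw [Finset.sum_range_succ]
    nlinarith [ih]

/-- `{B_j : j < p} = {0, …, p−1}`, as the sum `2 Σ_j B_j + p = p²` -/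
lemma liftB_sum {p n t₀ x : ℕ} (hp : p.Prime) (hn : 0 < n) (hx : ¬ p ∣ x) :
    2 * (∑ j ∈ range p, liftB p n t₀ x j) + p = p * p := by
  have h : ∑ i ∈ (range p).image (liftB p n t₀ x), i = ∑ j ∈ range p, liftB p n t₀ x j :=
    Finset.sum_image (liftB_injOn hp hn hx)
  rw [liftB_image hp hn hx] at h
  rw [← h]
  exact gauss p

/-- **Lift sum.** For `p ∤ x`: `2 Σ_{j<p} ⟨(t₀ + jn)x⟩_{pn} + pn = 2p⟨t₀x⟩_n + p²n`
(i.e. `Σ_j = p⟨t₀x⟩_n + n·p(p−1)/2`). -/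
lemma lift_sum (p n t₀ x : ℕ) (hp : p.Prime) (hn : 0 < n) (hx : ¬ p ∣ x) :
    2 * (∑ j ∈ range p, (t₀ + j * n) * x % (p * n)) + p * n
      = 2 * (p * (t₀ * x % n)) + p * p * n := by
  have hrepr : ∀ j ∈ range p, (t₀ + j * n) * x % (p * n) = n * liftB p n t₀ x j + t₀ * x % n :=
    fun j _ => (liftB_spec p n t₀ x j hn hp.pos).2
  rw [Finset.sum_congr rfl hrepr, Finset.sum_add_distrib, Finset.sum_const, Finset.card_range,
    smul_eq_mul, ← Finset.mul_sum]
  have hB := liftB_sum (t₀ := t₀) hp hn hx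
  set S := ∑ j ∈ range p, liftB p n t₀ x j
  zify at hB ⊢
  linear_combination (n : ℤ) * hB

/-- the constant first residue of a Z1 triple: `⟨(t₀ + jn)·py⟩_{pn} = p⟨t₀y⟩_n` -/
lemma first_mod (p n t₀ y j : ℕ) : (t₀ + j * n) * (p * y) % (p * n) = p * (t₀ * y % n) := by
  have e : (t₀ + j * n) * (p * y) = p * (t₀ * y + (j * y) * n) := by ring
  rw [e, Nat.mul_mod_mul_left, Nat.add_mul_mod_self_right]


end HodgeFermat.KRFree.LemmaN
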